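import Mathlib
import HarnessLib
import Summits.AtomisticToContinuum.Crystallization.Theses.BrittleRungDescent
import Literature.MathematicalPhysics.StatisticalMechanics.LennardJonesClusters

/-!
# BrittleRungDescent — `LJKissingBalls` (item stmt-AtomisticToContinuum-9211)

Route `AtomisticToContinuum/Crystallization/BrittleRungDescent`, support item `LJKissingBalls`
(the bookkeeping glue `LocalHalesKernel → LJBondSpread → [hypothesis of LJBarlowRigidity]`).

## Proof

Take the scale `a > 0` of `LJBondSpread` and a Lennard-Jones ground-state sequence `x`.
Call an atom `j` of `x N` *kissed* when it is softly twelve-kissed at scale `a`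
(tolerance `1/400`, gap `63/50 · a`) and *good* when moreover its soft contact graph is the fcc
or the hcp pattern graph.

* `shell_of_localHalesKernel`: a kissed atom all of whose soft neighbours are kissed is good —
  rescale the (injective) configuration by `a⁻¹` and apply `LocalHalesKernel` to the point set
  `S = a⁻¹ • range (x N)`; the neighbour subtypes at scale `a` (indices) and at scale `1`
  (points of `S`) are in bijection, and the bijection respects the contact relations.
* `natCard_kissed_near_le`: kissed atoms are `a (1 - 1/400)`-separated from every other atom, so
  at most `14³ = 2744` kissed atoms lie within `6a` of any point (packing by volume,
  `card_le_of_separated_of_dist_le`).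
* `natCard_not_forall_le`: an atom whose `4a`-ball contains a non-good atom is either not kissed
  itself, or is a kissed atom within `6a` of a non-kissed atom; hence the number of such atoms is
  at most `(2744 + 1) · #(non-kissed)`.
* `tendsto_of_kissed`: squeeze with `LJBondSpread`.

No named fact is used; `IsGroundState` enters only through injectivity of the configurations.
-/

namespace Summit.AtomisticToContinuum.Crystallization.Theorems

open Literature.MathematicalPhysics.StatisticalMechanics Literature.Geometry.DiscreteGeometry
open Filter Topology

namespace LJKissingBalls

/-- Transport of "there is a bijection onto the pattern matching the contact relation" along an
equivalence of vertex types compatible with the contact relations. [folklore] -/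
theorem exists_equiv_rel_transfer {α α' β : Type*} (P : α → α → Prop) (P' : α' → α' → Prop)
    (R : β → β → Prop) (φ : α' ≃ α) (hφ : ∀ k k', k ≠ k' → (P' k k' ↔ P (φ k) (φ k')))
    (h : ∃ e : α ≃ β, ∀ w w', w ≠ w' → (P w w' ↔ R (e w) (e w'))) :
    ∃ e : α' ≃ β, ∀ k k', k ≠ k' → (P' k k' ↔ R (e k) (e k')) := by
  obtain ⟨e, he⟩ := h
  refine ⟨φ.trans e, fun k k' hkk' => ?_⟩
  rw [hφ k k' hkk', he (φ k) (φ k') (fun h => hkk' (φ.injective h))]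
  rfl

/-- Rescaling distances by `a⁻¹`, `a > 0`. [folklore] -/
theorem dist_inv_smul_eq {a : ℝ} (ha : 0 < a) (p q : EuclideanSpace ℝ (Fin 3)) :
    dist (a⁻¹ • p) (a⁻¹ • q) = a⁻¹ * dist p q := by
  rw [dist_smul₀, Real.norm_eq_abs, abs_of_pos (inv_pos.2 ha)]

/-- Rescaled upper distance bounds. [folklore] -/
theorem dist_inv_smul_le_iff {a : ℝ} (ha : 0 < a) (p q : EuclideanSpace ℝ (Fin 3)) (c : ℝ) :
    dist (a⁻¹ • p) (a⁻¹ • q) ≤ c ↔ dist p q ≤ a * c := by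
  rw [dist_inv_smul_eq ha, inv_mul_le_iff₀ ha]

/-- Rescaled lower distance bounds. [folklore] -/
theorem le_dist_inv_smul_iff {a : ℝ} (ha : 0 < a) (p q : EuclideanSpace ℝ (Fin 3)) (c : ℝ) :
    c ≤ dist (a⁻¹ • p) (a⁻¹ • q) ↔ a * c ≤ dist p q := by
  rw [dist_inv_smul_eq ha, le_inv_mul_iff₀ ha]

/-- **Local Hales, indexed and rescaled.** In an injective configuration `x : Fin N → ℝ³`, if
the atom `j` and every atom within `a (1 + 1/400)` of it are softly twelve-kissed at scale
`a > 0` (tolerance `1/400`, gap `63/50 · a`), then `LocalHalesKernel` (applied to the point set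
`a⁻¹ • range x`) makes the soft contact graph on the twelve soft neighbours of `j` the fcc or the
hcp pattern graph. [folklore] -/
theorem shell_of_localHalesKernel
    (hLH : Summit.AtomisticToContinuum.Crystallization.Theses.BrittleRungDescent.LocalHalesKernel)
    {N : ℕ} {x : Fin N → EuclideanSpace ℝ (Fin 3)} (hx : Function.Injective x) {a : ℝ} (ha : 0 < a)
    (j : Fin N)
    (hKj : (∀ l : Fin N, l ≠ j → a * (1 - 1 / 400) ≤ dist (x j) (x l) ∧
        (dist (x j) (x l) ≤ a * (1 + 1 / 400) ∨ 63 / 50 * a ≤ dist (x j) (x l))) ∧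
      Nat.card {l : Fin N // l ≠ j ∧ dist (x j) (x l) ≤ a * (1 + 1 / 400)} = 12)
    (hnb : ∀ l : Fin N, l ≠ j → dist (x j) (x l) ≤ a * (1 + 1 / 400) →
      (∀ l' : Fin N, l' ≠ l → a * (1 - 1 / 400) ≤ dist (x l) (x l') ∧
          (dist (x l) (x l') ≤ a * (1 + 1 / 400) ∨ 63 / 50 * a ≤ dist (x l) (x l'))) ∧
        Nat.card {l' : Fin N // l' ≠ l ∧ dist (x l) (x l') ≤ a * (1 + 1 / 400)} = 12) :
    (∃ e : {k : Fin N // k ≠ j ∧ dist (x j) (x k) ≤ a * (1 + 1 / 400)} ≃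
        {q : EuclideanSpace ℝ (Fin 3) // q ∈ fccKissingPattern},
        ∀ k k' : {k : Fin N // k ≠ j ∧ dist (x j) (x k) ≤ a * (1 + 1 / 400)}, k ≠ k' →
          (dist (x k.1) (x k'.1) ≤ a * (1 + 1 / 400) ↔ dist (e k).1 (e k').1 = 1)) ∨
      (∃ e : {k : Fin N // k ≠ j ∧ dist (x j) (x k) ≤ a * (1 + 1 / 400)} ≃
        {q : EuclideanSpace ℝ (Fin 3) // q ∈ hcpKissingPattern},
        ∀ k k' : {k : Fin N // k ≠ j ∧ dist (x j) (x k) ≤ a * (1 + 1 / 400)}, k ≠ k' →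
          (dist (x k.1) (x k'.1) ≤ a * (1 + 1 / 400) ↔ dist (e k).1 (e k').1 = 1)) := by
  -- the rescaled configuration
  set g : Fin N → EuclideanSpace ℝ (Fin 3) := fun l => a⁻¹ • x l with hg_def
  have hg : Function.Injective g := fun l l' h =>
    hx (smul_right_injective (EuclideanSpace ℝ (Fin 3)) (inv_ne_zero ha.ne') h)
  have hle : ∀ l l' (c : ℝ), dist (g l) (g l') ≤ c ↔ dist (x l) (x l') ≤ a * c :=
    fun l l' c => dist_inv_smul_le_iff ha _ _ c
  have hge : ∀ l l' (c : ℝ), c ≤ dist (g l) (g l') ↔ a * c ≤ dist (x l) (x l') :=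
    fun l l' c => le_dist_inv_smul_iff ha _ _ c
  set S : Set (EuclideanSpace ℝ (Fin 3)) := Set.range g with hS_def
  -- the kissing condition at scale `a` for an index `l`, merged form
  have hK : ∀ l : Fin N, dist (x j) (x l) ≤ a * (1 + 1 / 400) →
      (∀ l' : Fin N, l' ≠ l → a * (1 - 1 / 400) ≤ dist (x l) (x l') ∧
          (dist (x l) (x l') ≤ a * (1 + 1 / 400) ∨ 63 / 50 * a ≤ dist (x l) (x l'))) ∧
        Nat.card {l' : Fin N // l' ≠ l ∧ dist (x l) (x l') ≤ a * (1 + 1 / 400)} = 12 := by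
    intro l hl
    by_cases h : l = j
    · subst h; exact hKj
    · exact hnb l h hl
  -- hypothesis of `LocalHalesKernel` for `S` at `u = g j`
  have hyp : ∀ v ∈ S, dist (g j) v ≤ 1 + 1 / 400 →
      ((∀ w ∈ S, w ≠ v → 1 - 1 / 400 ≤ dist v w ∧ (dist v w ≤ 1 + 1 / 400 ∨ 63 / 50 ≤ dist v w)) ∧
        {w ∈ S | w ≠ v ∧ dist v w ≤ 1 + 1 / 400}.ncard = 12) := by
    rintro v ⟨l, rfl⟩ hl
    obtain ⟨hK1, hK2⟩ := hK l ((hle j l _).1 hl)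
    refine ⟨?_, ?_⟩
    · rintro w ⟨l', rfl⟩ hne
      have hll' : l' ≠ l := fun h => hne (h ▸ rfl)
      obtain ⟨h1, h2⟩ := hK1 l' hll'
      refine ⟨(hge l l' _).2 h1, ?_⟩
      rcases h2 with h2 | h2
      · exact Or.inl ((hle l l' _).2 h2)
      · exact Or.inr ((hge l l' _).2 (by linarith))
    · have hset : {w ∈ S | w ≠ g l ∧ dist (g l) w ≤ 1 + 1 / 400} =
          g '' {l' : Fin N | l' ≠ l ∧ dist (x l) (x l') ≤ a * (1 + 1 / 400)} := by
        ext w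
        simp only [Set.mem_setOf_eq, Set.mem_image, hS_def, Set.mem_range]
        constructor
        · rintro ⟨⟨l', rfl⟩, hne, hd⟩
          exact ⟨l', ⟨fun h => hne (h ▸ rfl), (hle l l' _).1 hd⟩, rfl⟩
        · rintro ⟨l', ⟨hne, hd⟩, rfl⟩
          exact ⟨⟨l', rfl⟩, fun h => hne (hg h), (hle l l' _).2 hd⟩
      rw [hset, Set.ncard_image_of_injective _ hg, ← Nat.card_coe_set_eq]
      exact hK2
  have hconc := hLH S (g j) (Set.mem_range_self j) hyp
  -- the bijection between the two neighbour subtypes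
  let A' := {k : Fin N // k ≠ j ∧ dist (x j) (x k) ≤ a * (1 + 1 / 400)}
  let A := {w : EuclideanSpace ℝ (Fin 3) // w ∈ S ∧ w ≠ g j ∧ dist (g j) w ≤ 1 + 1 / 400}
  let f : A' → A := fun k =>
    ⟨g k.1, Set.mem_range_self _, fun h => k.2.1 (hg h), (hle j k.1 _).2 k.2.2⟩
  have hf : Function.Bijective f := by
    constructor
    · intro k k' h
      apply Subtype.ext
      apply hg
      have := congrArg Subtype.val h
      exact this
    · rintro ⟨w, ⟨l, rfl⟩, hne, hd⟩
      exact ⟨⟨l, fun h => hne (h ▸ rfl), (hle j l _).1 hd⟩, rfl⟩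
  let φ : A' ≃ A := Equiv.ofBijective f hf
  have hφ : ∀ k k' : A', k ≠ k' →
      ((dist (x k.1) (x k'.1) ≤ a * (1 + 1 / 400)) ↔ dist (φ k).1 (φ k').1 ≤ 1 + 1 / 400) := by
    intro k k' _
    show dist (x k.1) (x k'.1) ≤ a * (1 + 1 / 400) ↔ dist (g k.1) (g k'.1) ≤ 1 + 1 / 400
    exact (hle _ _ _).symm
  rcases hconc with h | h
  · exact Or.inl (exists_equiv_rel_transfer
      (fun w w' : A => dist w.1 w'.1 ≤ 1 + 1 / 400)
      (fun k k' : A' => dist (x k.1) (x k'.1) ≤ a * (1 + 1 / 400))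
      (fun q q' : {q : EuclideanSpace ℝ (Fin 3) // q ∈ fccKissingPattern} => dist q.1 q'.1 = 1)
      φ hφ h)
  · exact Or.inr (exists_equiv_rel_transfer
      (fun w w' : A => dist w.1 w'.1 ≤ 1 + 1 / 400)
      (fun k k' : A' => dist (x k.1) (x k'.1) ≤ a * (1 + 1 / 400))
      (fun q q' : {q : EuclideanSpace ℝ (Fin 3) // q ∈ hcpKissingPattern} => dist q.1 q'.1 = 1)
      φ hφ h)

/-- **Packing.** If the atoms satisfying `K` are at distance `≥ a (1 - 1/400)` from every other
atom (`a > 0`), then at most `14³ = 2744` of them lie within `6a` of any point of `ℝ³`: the bound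
`(2R/r + 1)³` of `card_le_of_separated_of_dist_le` with `R = 6a`, `r = (399/400) a` is
`(5199/399)³ ≤ 14³`. [folklore] -/
theorem natCard_kissed_near_le {N : ℕ} (x : Fin N → EuclideanSpace ℝ (Fin 3)) (K : Fin N → Prop)
    {a : ℝ} (ha : 0 < a)
    (hsep : ∀ i, K i → ∀ i', i' ≠ i → a * (1 - 1 / 400) ≤ dist (x i) (x i'))
    (p : EuclideanSpace ℝ (Fin 3)) :
    Nat.card {i : Fin N // K i ∧ dist (x i) p ≤ 6 * a} ≤ 2744 := by
  classical
  set T : Finset (Fin N) := Finset.univ.filter (fun i => K i ∧ dist (x i) p ≤ 6 * a) with hT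
  have hmem : ∀ i, i ∈ T ↔ K i ∧ dist (x i) p ≤ 6 * a := fun i => by simp [hT]
  have hr : (0 : ℝ) < a * (1 - 1 / 400) := by positivity
  have hinj : Set.InjOn x T := by
    intro i hi i' hi' h
    by_contra hne
    have := hsep i ((hmem i).1 hi).1 i' (Ne.symm hne)
    rw [h, dist_self] at this
    linarith
  have hcard : Nat.card {i : Fin N // K i ∧ dist (x i) p ≤ 6 * a} = (T.image x).card := by
    rw [Finset.card_image_of_injOn hinj, Nat.subtype_card T hmem]
  have hpack := card_le_of_separated_of_dist_le (T.image x) p hr (by positivity : (0 : ℝ) ≤ 6 * a)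
    (by
      intro c hc
      obtain ⟨i, hi, rfl⟩ := Finset.mem_image.1 hc
      exact ((hmem i).1 hi).2)
    (by
      intro c hc d hd hcd
      obtain ⟨i, hi, rfl⟩ := Finset.mem_image.1 hc
      obtain ⟨i', hi', rfl⟩ := Finset.mem_image.1 hd
      exact hsep i ((hmem i).1 hi).1 i' (fun h => hcd (h ▸ rfl)))
  rw [finrank_euclideanSpace_fin] at hpack
  have hq : (2 * (6 * a) / (a * (1 - 1 / 400)) + 1 : ℝ) = 5199 / 399 := by
    field_simp
    ring
  rw [hq] at hpack
  have h' : ((T.image x).card : ℝ) ≤ 2744 := hpack.trans (by norm_num)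
  rw [hcard]
  exact_mod_cast h'

/-- **Counting.** If at most `C` atoms satisfying `K` lie within `6a` of any atom, and a `K`-atom
all of whose `a (1 + 1/400)`-neighbours are `K`-atoms satisfies `G`, then the atoms whose
`4a`-ball contains an atom failing `K ∧ G` number at most `(C + 1) · #{¬ K}`: such an atom either
fails `K` itself or is a `K`-atom within `4a + a (1 + 1/400) ≤ 6a` of an atom failing `K`.
[folklore] -/
theorem natCard_not_forall_le {N : ℕ} (x : Fin N → EuclideanSpace ℝ (Fin 3)) (K G : Fin N → Prop)
    {a : ℝ} (ha : 0 ≤ a)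
    (C : ℕ) (hC : ∀ l : Fin N, Nat.card {i : Fin N // K i ∧ dist (x i) (x l) ≤ 6 * a} ≤ C)
    (hG : ∀ j, K j → (∀ l, l ≠ j → dist (x j) (x l) ≤ a * (1 + 1 / 400) → K l) → G j) :
    Nat.card {i : Fin N // ¬ ∀ j, dist (x i) (x j) ≤ 4 * a → K j ∧ G j} ≤
      (C + 1) * Nat.card {i : Fin N // ¬ K i} := by
  classical
  set B : Finset (Fin N) := Finset.univ.filter (fun i => ¬ K i) with hB
  set D : Fin N → Finset (Fin N) :=
    fun l => Finset.univ.filter (fun i => K i ∧ dist (x i) (x l) ≤ 6 * a) with hD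
  have hmemB : ∀ i, i ∈ B ↔ ¬ K i := fun i => by simp [hB]
  have hmemD : ∀ l i, i ∈ D l ↔ K i ∧ dist (x i) (x l) ≤ 6 * a := fun l i => by simp [hD]
  have hsub : Finset.univ.filter (fun i => ¬ ∀ j, dist (x i) (x j) ≤ 4 * a → K j ∧ G j) ⊆
      B ∪ B.biUnion D := by
    intro i hi
    simp only [Finset.mem_filter, Finset.mem_univ, true_and] at hi
    rw [Finset.mem_union, Finset.mem_biUnion]
    by_cases hKi : K i
    · right
      push Not at hi
      obtain ⟨j, hij, hj⟩ := hi
      by_cases hKj : K j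
      · have hGj : ¬ G j := hj hKj
        have hnb : ¬ ∀ l, l ≠ j → dist (x j) (x l) ≤ a * (1 + 1 / 400) → K l :=
          fun h => hGj (hG j hKj h)
        push Not at hnb
        obtain ⟨l, -, hjl, hKl⟩ := hnb
        refine ⟨l, (hmemB l).2 hKl, (hmemD l i).2 ⟨hKi, ?_⟩⟩
        calc dist (x i) (x l) ≤ dist (x i) (x j) + dist (x j) (x l) := dist_triangle _ _ _
          _ ≤ 4 * a + a * (1 + 1 / 400) := add_le_add hij hjl
          _ ≤ 6 * a := by linarith
      · refine ⟨j, (hmemB j).2 hKj, (hmemD j i).2 ⟨hKi, ?_⟩⟩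
        linarith
    · exact Or.inl ((hmemB i).2 hKi)
  have hDC : ∀ l, (D l).card ≤ C := fun l => by
    rw [← Nat.subtype_card (D l) (hmemD l)]
    exact hC l
  calc Nat.card {i : Fin N // ¬ ∀ j, dist (x i) (x j) ≤ 4 * a → K j ∧ G j}
        = (Finset.univ.filter (fun i => ¬ ∀ j, dist (x i) (x j) ≤ 4 * a → K j ∧ G j)).card :=
          Nat.subtype_card _ (fun i => by simp)
    _ ≤ (B ∪ B.biUnion D).card := Finset.card_le_card hsub
    _ ≤ B.card + (B.biUnion D).card := Finset.card_union_le _ _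
    _ ≤ B.card + ∑ l ∈ B, (D l).card := by gcongr; exact Finset.card_biUnion_le
    _ ≤ B.card + ∑ _l ∈ B, C := by gcongr with l; exact hDC l
    _ = (C + 1) * B.card := by rw [Finset.sum_const, smul_eq_mul]; ring
    _ = (C + 1) * Nat.card {i : Fin N // ¬ K i} := by rw [Nat.subtype_card B hmemB]

/-- **Squeeze.** For a sequence of configurations with predicates `K N` ("kissed") and `G N`
("good shell graph"): if `K`-atoms are `a (1 - 1/400)`-separated from all other atoms, a `K`-atom
with `K`-neighbours is `G`, and the fraction of non-`K` atoms tends to `0`, then the fraction of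
atoms whose `4a`-ball is not entirely `K ∧ G` tends to `0`. [folklore] -/
theorem tendsto_of_kissed {x : (N : ℕ) → Fin N → EuclideanSpace ℝ (Fin 3)} {a : ℝ} (ha : 0 < a)
    (K G : (N : ℕ) → Fin N → Prop)
    (hsep : ∀ N (i : Fin N), K N i → ∀ i', i' ≠ i → a * (1 - 1 / 400) ≤ dist (x N i) (x N i'))
    (hG : ∀ N (j : Fin N), K N j →
      (∀ l, l ≠ j → dist (x N j) (x N l) ≤ a * (1 + 1 / 400) → K N l) → G N j)
    (hB : Tendsto (fun N : ℕ => (Nat.card {i : Fin N // ¬ K N i} : ℝ) / N) atTop (𝓝 0)) :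
    Tendsto (fun N : ℕ =>
      (Nat.card {i : Fin N // ¬ ∀ j : Fin N, dist (x N i) (x N j) ≤ 4 * a → (K N j ∧ G N j)} : ℝ)
        / N) atTop (𝓝 0) := by
  have h0 := hB.const_mul (((2744 : ℕ) : ℝ) + 1)
  rw [mul_zero] at h0
  refine squeeze_zero (fun N => by positivity) (fun N => ?_) h0
  rw [← mul_div_assoc]
  refine div_le_div_of_nonneg_right ?_ (Nat.cast_nonneg N)
  have h := natCard_not_forall_le (x N) (K N) (G N) ha.le 2744
    (fun l => natCard_kissed_near_le (x N) (K N) ha (hsep N) (x N l)) (hG N)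
  exact_mod_cast h

end LJKissingBalls

/-- **Item `stmt-AtomisticToContinuum-9211` (`LJKissingBalls`), proved.** From
`LocalHalesKernel` and `LJBondSpread`: with the scale `a` of `LJBondSpread`, along every
sequence of Lennard-Jones ground states all but `o(N)` atoms have a `4a`-ball in which every atom
is softly twelve-kissed at scale `a` (tolerance `1/400`, gap `63/50 · a`) with an fcc/hcp soft
contact graph on its shell. Bookkeeping: packing of kissed atoms (`natCard_kissed_near_le`),
the local Hales step rescaled (`shell_of_localHalesKernel`, using only injectivity of ground
states), counting (`natCard_not_forall_le`) and a squeeze (`tendsto_of_kissed`). [folklore] -/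
theorem LJKissingBalls_proof :
    Summit.AtomisticToContinuum.Crystallization.Theses.BrittleRungDescent.LJKissingBalls := by
  intro hLH hBS
  obtain ⟨a, ha, hBS⟩ := hBS
  refine ⟨a, ha, fun x hx => ?_⟩
  refine LJKissingBalls.tendsto_of_kissed ha _ _ ?_ ?_ (hBS x hx)
  · intro N i hKi i' hi'
    exact (hKi.1 i' hi').1
  · intro N j hKj hnb
    exact LJKissingBalls.shell_of_localHalesKernel hLH (hx N).1 ha j hKj hnb

end Summit.AtomisticToContinuum.Crystallization.Theorems
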